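import Literature.AlgebraicGeometry.ShimuraVarieties.UnitaryCanonicalDescentPredicates
import Literature.AlgebraicGeometry.ShimuraVarieties.UnitaryShimuraHeckeDescent
import Literature.AlgebraicGeometry.ShimuraVarieties.UnitaryShimuraReciprocityTwistInvariance
import HarnessLib

/-!
# The complex Galois datum of the unitary Shimura tower: semilinear automorphisms of the complex models
# pinned by Shimura reciprocity ([Deligne 1971] Prop. 5.10 proof; [Milne 2005] Thm. 13.6 / Lemma 13.5 / Prop. 13.1)

Topic `AlgebraicGeometry/ShimuraVarieties`; namespace `Literature.AlgebraicGeometry.ShimuraVarieties.UnitaryCanonicalModel`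
(grouping sub-namespace `ComplexRecordSystem`, the complex tower `Sc.Mc : C5.SmallLevel K₀ ⥤ SchemeOver ℂ` of
`UnitaryShimuraComplexRecordSystem`).  THEOREMS ONLY (no definition, no instance, no named fact, no `sorry`).  Cell
`hodgecm-mathlib` (D-0151), row I-6 `descentToIntersection_printed` ([Deligne1971TravauxShimura] Prop. 5.10), HALF (Λ)
«complex semilinear datum» of the crew's cut (director g2 batch 19): the objects from which the descent datum of the
`_holds` proof is built.  Net Literature debt 0.

## What is proved (the «Langlands conjugation» of the tower in the trivial case `σ|E(G,X) = 1`, pinned on special points)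

Fix the hDel datum `(L, H, τ, T, hT, K₀)`, a complex record system `Sc`, a level `K` and a ring automorphism `σ` of `ℂ`
fixing `τ(L)`.  A **Galois twist automorphism** of `Sc.Mc_K` for `σ` is an automorphism `λ` of the SCHEME `(Sc.Mc_K).left`
covering `Spec σ⁻¹` (`λ ≫ p = p ≫ Spec σ⁻¹`, the convention of the tree's `GaloisDescent.gal = 1 × Spec σ⁻¹`) whose
semilinear point action `P ↦ Spec σ ≫ P ≫ λ` sends the special point `Sc.pts⁻¹[x₀, aK]` of the Hecke orbit of the CM point
`x₀` of a negative `L`-line to `Sc.pts⁻¹[x₀, r_{x₀}(s)·aK]` — Shimura reciprocity (62) ([Milne2005ShimuraVarieties] Def. 12.8)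
for an Artin correspondent `s` of `σ` and the diagonal twist `r_{x₀}(s)`.  We prove:

* §1 `hom_eq_of_eq_on_heckeOrbit` — two `ℂ`-morphisms `Sc.Mc_K → Sc.Mc_{K'}` agreeing on the Hecke orbit `{Sc.pts⁻¹[x₀, aK]}_a`
  of one point are equal (Lemma 13.5 = `Deligne1971.eq_of_forall_mk_eq`, continuity of `AlgPoints.map`, Hausdorffness of
  `Mc_{K'}(ℂ)`, `SchemeOver.hom_ext_of_forall_algPoints`);
* §2 `galoisTwistAut_unique` — for each `σ` there is AT MOST ONE Galois twist automorphism at level `K` (any two Artin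
  correspondents ∕ twists give the same special points, `kernelTwistInvariance`; the `ℂ`-linear `λ⁻¹ ≫ λ′` fixes the Hecke
  orbit, §1); `galoisTwistAut_natural` — the twist automorphisms commute with the transition morphisms of the tower;
* §3 `galoisTwistAut_transport` ∕ `exists_galoisTwistAut_of_isCanonicalDescentOver` — EXISTENCE for `σ ∈ Aut(ℂ/E)` whenever
  the tower has an `E`-form `(M, e)` with reciprocity over `E ⊇ τ(L)` (`IsCanonicalDescentOver`): the transport
  `e_K⁻¹ ≫ gal σ ≫ e_K` of the tree's `GaloisDescent.gal ℂ (M_K) σ` along `e_K` IS a twist automorphism (point action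
  `lift_comp_gal` + (62); abstract point bookkeeping `specMap_comp_comp_conj_gal_eq`);
* §4 `galoisTwistAut_one`, `galoisTwistAut_mul`, `galoisTwistAut_symm`, `galoisTwistAut_pt_of_pt` — the identity is a twist
  automorphism for `σ = 1`, composites ∕ inverses of twist automorphisms are twist automorphisms for `σ·τ` ∕ `σ⁻¹`, and the point
  action may be read with any Artin correspondent of `σ` (`kernelTwistInvariance`).

The sequel `UnitaryShimuraComplexGaloisDatumAssembly` multiplies the reciprocity data and assembles, by closure induction, a twist
automorphism for every `σ` in the subgroup generated by the `Aut(ℂ/Eᵢ)` of a family of forms — with the GENERATION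
`Aut(ℂ/⋂Eᵢ) = ⟨⋃ Aut(ℂ/Eᵢ)⟩` this is the semilinear `Aut(ℂ/⋂Eᵢ)`-datum on the complex tower which the algebraic half descends
([Deligne1971TravauxShimura] Lemme 5.10.1; [GortzWedhorn2020] Thm. 14.83).

HC_CM is proved only modulo the 7 printed citations until rung 0 closes; this file discharges none of them by itself.

## References
* [Deligne1971TravauxShimura] P. Deligne, *Travaux de Shimura*, Sém. Bourbaki 389 (1971): Prop. 5.10 pp. 157–158 and Lemme 5.10.1 p. 158, Cor. 5.5 p. 156.
* [Milne2005ShimuraVarieties] J. S. Milne, *Introduction to Shimura varieties* (2005/2017): Prop. 13.1 p. 117, Lemma 13.5,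
  Thm. 13.6 p. 118, Def. 12.8 (62) p. 114.
* [GortzWedhorn2020] U. Görtz, T. Wedhorn, *Algebraic Geometry I*, §(14.20), Thm. 14.83.
-/

set_option autoImplicit false

noncomputable section

open Function MulAction Topology NumberField IsDedekindDomain CategoryTheory CategoryTheory.Limits Matrix
  AlgebraicGeometry Cardinal
open scoped Matrix ComplexOrder
open Literature.AlgebraicGeometry.Motives
open Literature.NumberTheory.Automorphic Literature.NumberTheory.Automorphic.UnitaryGroup
open Literature.NumberTheory.Automorphic.Liu2021.AppendixC (C5.OpenCompactSubgroup C5.SmallLevel)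
open Literature.Geometry.ComplexHyperbolic Literature.Geometry.ComplexHyperbolic.BallModel
open Literature.NumberTheory.Automorphic.ShimuraDissection

namespace Literature.AlgebraicGeometry.ShimuraVarieties.UnitaryCanonicalModel

variable {L : Type} [Field L] [NumberField L] [IsCMField L] {H : Matrix (Fin 3) (Fin 3) L}
  {τ : L →+* ℂ} {T : GL (Fin 3) ℂ} {hT : formCongr (starRingEnd ℂ) T (H.map τ) = BallModel.J}
  {K₀ : C5.OpenCompactSubgroup ↥(finAdelic (↥(maximalRealSubfield L)) L (IsCMField.complexConj L) 3 H)}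

/-! ### §0. Bookkeeping on `Spec` of ring automorphisms of `ℂ` -/

/-- `Spec σ⁻¹ ≫ Spec σ = 1` for a ring automorphism `σ` of `ℂ` (contravariance of `Spec`; the Galois action on the base of
[GortzWedhorn2020] §(14.20)). [cite: GortzWedhorn2020, §(14.20) (14.20.1)] -/
theorem specMap_ringEquiv_symm_comp (σ : ℂ ≃+* ℂ) :
    Spec.map (CommRingCat.ofHom (σ.symm : ℂ →+* ℂ)) ≫ Spec.map (CommRingCat.ofHom (σ : ℂ →+* ℂ)) = 𝟙 _ := by
  rw [← Spec.map_comp, ← CommRingCat.ofHom_comp]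
  have h : (σ.symm : ℂ →+* ℂ).comp (σ : ℂ →+* ℂ) = RingHom.id ℂ := RingHom.ext fun x => σ.symm_apply_apply x
  rw [h, CommRingCat.ofHom_id]
  exact Spec.map_id _

/-- `Spec σ ≫ Spec σ⁻¹ = 1` for a ring automorphism `σ` of `ℂ` (contravariance of `Spec`; [GortzWedhorn2020] §(14.20)).
[cite: GortzWedhorn2020, §(14.20) (14.20.1)] -/
theorem specMap_ringEquiv_comp_symm (σ : ℂ ≃+* ℂ) :
    Spec.map (CommRingCat.ofHom (σ : ℂ →+* ℂ)) ≫ Spec.map (CommRingCat.ofHom (σ.symm : ℂ →+* ℂ)) = 𝟙 _ := by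
  rw [← Spec.map_comp, ← CommRingCat.ofHom_comp]
  have h : (σ : ℂ →+* ℂ).comp (σ.symm : ℂ →+* ℂ) = RingHom.id ℂ := RingHom.ext fun x => σ.apply_symm_apply x
  rw [h, CommRingCat.ofHom_id]
  exact Spec.map_id _

/-- `Spec (σρ) = Spec σ ≫ Spec ρ` for ring automorphisms of `ℂ` (`Spec` is contravariant and `(σρ)(x) = σ(ρ(x))`, so the
two reversals cancel; cf. `AbelianVariety.specAut_mul`; [GortzWedhorn2020] §(14.20)). [cite: GortzWedhorn2020, §(14.20) (14.20.1)] -/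
theorem specMap_ringEquiv_mul (σ ρ : ℂ ≃+* ℂ) :
    Spec.map (CommRingCat.ofHom ((σ * ρ : ℂ ≃+* ℂ) : ℂ →+* ℂ)) =
      Spec.map (CommRingCat.ofHom (σ : ℂ →+* ℂ)) ≫ Spec.map (CommRingCat.ofHom (ρ : ℂ →+* ℂ)) := by
  rw [← Spec.map_comp, ← CommRingCat.ofHom_comp]
  have h : ((σ * ρ : ℂ ≃+* ℂ) : ℂ →+* ℂ) = (σ : ℂ →+* ℂ).comp (ρ : ℂ →+* ℂ) := RingHom.ext fun x => rfl
  rw [h]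

/-- `Spec (σρ)⁻¹ = Spec ρ⁻¹ ≫ Spec σ⁻¹` for ring automorphisms of `ℂ` ([GortzWedhorn2020] §(14.20): `σ ↦ Spec σ⁻¹` is a
homomorphism). [cite: GortzWedhorn2020, §(14.20) (14.20.1)] -/
theorem specMap_ringEquiv_mul_symm (σ ρ : ℂ ≃+* ℂ) :
    Spec.map (CommRingCat.ofHom ((σ * ρ).symm : ℂ →+* ℂ)) =
      Spec.map (CommRingCat.ofHom (ρ.symm : ℂ →+* ℂ)) ≫ Spec.map (CommRingCat.ofHom (σ.symm : ℂ →+* ℂ)) := by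
  rw [← Spec.map_comp, ← CommRingCat.ofHom_comp]
  have h : ((σ * ρ).symm : ℂ →+* ℂ) = (ρ.symm : ℂ →+* ℂ).comp (σ.symm : ℂ →+* ℂ) := RingHom.ext fun x => rfl
  rw [h]

/-- **The semilinear point action of a transported Galois automorphism** (abstract form of [Milne2005ShimuraVarieties] §13
p. 118 L21–26: «`σ` acts on `V(ℂ)`»): let `X` be an `E`-scheme, `σ ∈ Aut(ℂ/E)` with underlying ring automorphism `σ′`,
`Q, Q′ ∈ X(ℂ)` with `σ • Q = Q′`, `eL : X ⊗_E ℂ ≅ Y` an isomorphism of schemes and `p, p′ : Spec ℂ → Y` the points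
corresponding to `(Q, 1)`, `(Q′, 1)` under `eL`.  Then the automorphism `eL⁻¹ ≫ (1 × Spec σ⁻¹) ≫ eL` of `Y` sends `p` to `p′`
semilinearly: `Spec σ′ ≫ p ≫ eL⁻¹ ≫ gal σ ≫ eL = p′` (`lift_comp_gal`).  Stated for VARIABLE points so that consumers
instantiate by `exact` (no definitional unfolding of concrete special points). [cite: Milne2005ShimuraVarieties, §13 p. 118 L21–26; Prop. 13.1 p. 117] -/
theorem specMap_comp_comp_conj_gal_eq {E : Type} [Field E] {ιE : E →+* ℂ} (X : SchemeOver E) {Y : Scheme}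
    (σ : letI : Algebra E ℂ := ιE.toAlgebra; ℂ ≃ₐ[E] ℂ) (σ' : ℂ ≃+* ℂ)
    (hσ' : letI : Algebra E ℂ := ιE.toAlgebra
      AbelianVariety.specAut ℂ σ⁻¹ = Spec.map (CommRingCat.ofHom (σ'.symm : ℂ →+* ℂ)))
    (Q Q' : letI : Algebra E ℂ := ιE.toAlgebra; ComplexPoints X) (hQ : letI : Algebra E ℂ := ιE.toAlgebra; σ • Q = Q')
    (eL : letI : Algebra E ℂ := ιE.toAlgebra; GaloisDescent.bc ℂ X ≅ Y) (p p' : Spec (.of ℂ) ⟶ Y)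
    (hp : letI : Algebra E ℂ := ιE.toAlgebra; p ≫ eL.inv = (AlgPoints.baseChangeEquiv ιE X Q).left)
    (hp' : letI : Algebra E ℂ := ιE.toAlgebra; p' ≫ eL.inv = (AlgPoints.baseChangeEquiv ιE X Q').left) :
    letI : Algebra E ℂ := ιE.toAlgebra
    Spec.map (CommRingCat.ofHom (σ' : ℂ →+* ℂ)) ≫ p ≫ eL.inv ≫ GaloisDescent.gal ℂ X σ ≫ eL.hom = p' := by
  letI : Algebra E ℂ := ιE.toAlgebra
  subst hQ
  have h3 := lift_comp_gal (τ := ιE) X σ Q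
  rw [lift_eq_baseChangeEquiv_left, lift_eq_baseChangeEquiv_left, ← hp, ← hp'] at h3
  have hS : Spec.map (CommRingCat.ofHom (σ' : ℂ →+* ℂ)) ≫ AbelianVariety.specAut ℂ σ⁻¹ = 𝟙 _ := by
    rw [hσ', specMap_ringEquiv_comp_symm]
  rw [← Category.assoc p eL.inv, ← Category.assoc (p ≫ eL.inv), h3, Category.assoc, Category.assoc, reassoc_of% hS,
    Iso.inv_hom_id, Category.comp_id]

namespace ComplexRecordSystem

/-! ### §1. `ℂ`-morphisms of the complex tower are pinned by one Hecke orbit ([Milne2005ShimuraVarieties] Lemma 13.5) -/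

/-- **Two `ℂ`-morphisms `Sc.Mc_K → Sc.Mc_{K'}` which agree on the Hecke orbit `{Sc.pts⁻¹[x₀, aK]}_a` of ONE point
`x₀ ∈ 𝔹²` are equal**: the orbit is dense in `Mc_K(ℂ) ≃ Sh_K(ℂ)` ([Milne2005ShimuraVarieties] Lemma 13.5, real approximation;
the tree's `Deligne1971.eq_of_forall_mk_eq`), both maps are continuous on complex points (`AlgPoints.continuous_map`),
`Mc_{K'}(ℂ)` is Hausdorff (`Mc_{K'}` projective), and complex points separate `ℂ`-morphisms out of the reduced `Mc_K`
(`SchemeOver.hom_ext_of_forall_algPoints`). [cite: Milne2005ShimuraVarieties, Lemma 13.5 p. 118 L13–20; Thm. 13.6 proof p. 118 L39–41] -/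
theorem hom_eq_of_eq_on_heckeOrbit (Sc : ComplexRecordSystem L H τ T hT K₀) {K K' : C5.SmallLevel K₀} (x₀ : Ball)
    (u v : Sc.Mc.obj K ⟶ Sc.Mc.obj K')
    (h : ∀ a : finAdelic (↥(maximalRealSubfield L)) L (IsCMField.complexConj L) 3 H,
      AlgPoints.map u ((Sc.pts K).symm (ShimuraSet.mk L H τ T hT K.1.1 x₀ a)) =
        AlgPoints.map v ((Sc.pts K).symm (ShimuraSet.mk L H τ T hT K.1.1 x₀ a))) :
    u = v := by
  -- hermitian-ness of `H` (from the frame), instances on the complex models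
  have hH : ∀ i j, cmConjRingHom L (H i j) = H j i := cmConjRingHom_apply_eq_of_formCongr_eq_J L H τ T hT
  have hHt : (H.map (IsCMField.complexConj L))ᵀ = H := transpose_map_complexConj_eq hH
  haveI : SmoothOfRelativeDimension 2 (Sc.Mc.obj K).hom := Sc.smooth K
  haveI : Smooth (Sc.Mc.obj K).hom := SmoothOfRelativeDimension.smooth 2 _
  haveI : IsReduced (Sc.Mc.obj K).left := isReduced_of_smooth_over_field (Sc.Mc.obj K).hom
  haveI : IsProper (Sc.Mc.obj K').hom := (Sc.projective K').isProper
  haveI : T2Space (ComplexPoints (Sc.Mc.obj K')) := ComplexPoints.t2Space_of_isSeparated _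
  -- agree on the dense Hecke orbit, hence on all complex points (Lemma 13.5), hence equal
  have hfun : (fun p => AlgPoints.map u ((Sc.pts K).symm p)) = fun p => AlgPoints.map v ((Sc.pts K).symm p) :=
    Deligne1971.eq_of_forall_mk_eq L H τ T hT K.1.1 hHt x₀
      ((AlgPoints.continuous_map u).comp (Sc.pts K).symm.continuous)
      ((AlgPoints.continuous_map v).comp (Sc.pts K).symm.continuous) h
  refine SchemeOver.hom_ext_of_forall_algPoints ℂ fun P => ?_
  have hP := congrFun hfun (Sc.pts K P)
  simp only [Homeomorph.symm_apply_apply, AlgPoints.map_apply] at hP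
  exact hP

/-! ### §2. Uniqueness and naturality of the Galois twist automorphisms -/

/-- **At most one Galois twist automorphism per `σ` and level** ([Milne2005ShimuraVarieties] Thm. 13.6 proof pattern): if `λ`
and `λ′` are automorphisms of the scheme `(Sc.Mc_K).left` covering `Spec σ⁻¹` whose semilinear point actions send
`Sc.pts⁻¹[x₀, aK] ↦ Sc.pts⁻¹[x₀, d·aK]`, resp. `↦ Sc.pts⁻¹[x₀, d′·aK]`, for Artin correspondents `s, s′` of `σ` and diagonal
twists `d, d′` by `r_{x₀}(s), r_{x₀}(s′)` at the CM point `x₀` of a negative `L`-line, then `λ = λ′`: the two twisted orbits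
coincide (`kernelTwistInvariance`), so the `ℂ`-LINEAR automorphism `λ⁻¹ ≫ λ′` fixes the Hecke orbit of `x₀`, hence is the
identity (§1). [cite: Milne2005ShimuraVarieties, Thm. 13.6 p. 118 L29–41; Def. 12.8 (62) p. 114] -/
theorem galoisTwistAut_unique (Sc : ComplexRecordSystem L H τ T hT K₀) (K : C5.SmallLevel K₀) (σ : ℂ ≃+* ℂ)
    {v₃ : Fin 3 → L} {x₀ : Ball} (hx₀ : IsLinePoint L τ T v₃ x₀)
    {s s' : (FiniteAdeleRing (𝓞 L) L)ˣ} (hs : IsArtinCorrespondent L τ s σ) (hs' : IsArtinCorrespondent L τ s' σ)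
    {d d' : finAdelic (↥(maximalRealSubfield L)) L (IsCMField.complexConj L) 3 H}
    (hd : IsDiagTwist L H v₃ (recipFactor L s) d) (hd' : IsDiagTwist L H v₃ (recipFactor L s') d')
    (lam lam' : (Sc.Mc.obj K).left ≅ (Sc.Mc.obj K).left)
    (hlam : lam.hom ≫ (Sc.Mc.obj K).hom = (Sc.Mc.obj K).hom ≫ Spec.map (CommRingCat.ofHom (σ.symm : ℂ →+* ℂ)))
    (hpt : ∀ a : finAdelic (↥(maximalRealSubfield L)) L (IsCMField.complexConj L) 3 H,
      Spec.map (CommRingCat.ofHom (σ : ℂ →+* ℂ)) ≫ ((Sc.pts K).symm (ShimuraSet.mk L H τ T hT K.1.1 x₀ a)).toSpecHom ≫ lam.hom =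
        ((Sc.pts K).symm (ShimuraSet.mk L H τ T hT K.1.1 x₀ (d * a))).toSpecHom)
    (hlam' : lam'.hom ≫ (Sc.Mc.obj K).hom = (Sc.Mc.obj K).hom ≫ Spec.map (CommRingCat.ofHom (σ.symm : ℂ →+* ℂ)))
    (hpt' : ∀ a : finAdelic (↥(maximalRealSubfield L)) L (IsCMField.complexConj L) 3 H,
      Spec.map (CommRingCat.ofHom (σ : ℂ →+* ℂ)) ≫ ((Sc.pts K).symm (ShimuraSet.mk L H τ T hT K.1.1 x₀ a)).toSpecHom ≫ lam'.hom =
        ((Sc.pts K).symm (ShimuraSet.mk L H τ T hT K.1.1 x₀ (d' * a))).toSpecHom) :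
    lam = lam' := by
  have hv : hermForm (cmConjRingHom L) H v₃ v₃ ≠ 0 := hermForm_self_ne_zero_of_isLinePoint L H τ T hT hx₀
  -- the two twisted orbits coincide (the twist class depends only on `σ`)
  have hfix : ∀ a : finAdelic (↥(maximalRealSubfield L)) L (IsCMField.complexConj L) 3 H,
      ShimuraSet.mk L H τ T hT K.1.1 x₀ (d' * a) = ShimuraSet.mk L H τ T hT K.1.1 x₀ (d * a) := fun a =>
    (shimuraSet_mk_twist_eq_of_isArtinCorrespondent L H τ T hT K.1.1 hs hs' hv hx₀ hd hd' a).symm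
  -- `λ⁻¹` covers `Spec σ`
  have hinv : lam.inv ≫ (Sc.Mc.obj K).hom = (Sc.Mc.obj K).hom ≫ Spec.map (CommRingCat.ofHom (σ : ℂ →+* ℂ)) := by
    have h := congrArg (fun f => lam.inv ≫ f ≫ Spec.map (CommRingCat.ofHom (σ : ℂ →+* ℂ))) hlam
    simp only [Iso.inv_hom_id_assoc, Category.assoc] at h
    rw [specMap_ringEquiv_symm_comp, Category.comp_id] at h
    exact h.symm
  -- the `ℂ`-linear automorphism `λ⁻¹ ≫ λ'`
  have hμ : (lam.inv ≫ lam'.hom) ≫ (Sc.Mc.obj K).hom = (Sc.Mc.obj K).hom := by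
    rw [Category.assoc, hlam', reassoc_of% hinv, specMap_ringEquiv_comp_symm, Category.comp_id]
  let μ : Sc.Mc.obj K ⟶ Sc.Mc.obj K := Over.homMk (lam.inv ≫ lam'.hom) hμ
  -- it fixes the Hecke orbit of `x₀`
  have horbit : ∀ b : finAdelic (↥(maximalRealSubfield L)) L (IsCMField.complexConj L) 3 H,
      AlgPoints.map μ ((Sc.pts K).symm (ShimuraSet.mk L H τ T hT K.1.1 x₀ b)) =
        AlgPoints.map (𝟙 (Sc.Mc.obj K)) ((Sc.pts K).symm (ShimuraSet.mk L H τ T hT K.1.1 x₀ b)) := by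
    intro b
    obtain ⟨a, rfl⟩ : ∃ a, d * a = b := ⟨d⁻¹ * b, mul_inv_cancel_left d b⟩
    apply Over.OverMorphism.ext
    change ((Sc.pts K).symm (ShimuraSet.mk L H τ T hT K.1.1 x₀ (d * a))).toSpecHom ≫ (lam.inv ≫ lam'.hom) =
      ((Sc.pts K).symm (ShimuraSet.mk L H τ T hT K.1.1 x₀ (d * a))).toSpecHom ≫ 𝟙 _
    rw [Category.comp_id, ← hpt a]
    simp only [Category.assoc, Iso.hom_inv_id_assoc]
    rw [hpt' a, hfix a]
    exact (hpt a).symm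
  -- hence it is the identity (§1), i.e. `λ = λ'`
  have hμ1 : μ = 𝟙 (Sc.Mc.obj K) := hom_eq_of_eq_on_heckeOrbit Sc x₀ μ (𝟙 _) horbit
  have h1 : lam.inv ≫ lam'.hom = 𝟙 _ := congrArg CommaMorphism.left hμ1
  ext
  rw [← Category.comp_id lam.hom, ← h1, Iso.hom_inv_id_assoc]

/-- **The Galois twist automorphisms commute with the transition morphisms of the tower**: if `λ_K`, `λ_{K'}` are twist
automorphisms for the same `σ` (same Artin correspondent and twist) at levels `K ≤ K'`, then
`λ_K ≫ (Mc_K → Mc_{K'}) = (Mc_K → Mc_{K'}) ≫ λ_{K'}`: the `ℂ`-linear `λ_K⁻¹ ≫ (Mc_K → Mc_{K'}) ≫ λ_{K'}` and the transition morphism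
agree on the Hecke orbit of `x₀` (`Sc.map_pts`: `[z, aK] ↦ [z, aK']`), hence everywhere (§1).
[cite: Deligne1971TravauxShimura, Prop. 5.10 proof (compatibility of the system with the levels)] [cite: Milne2005ShimuraVarieties, Thm. 13.6 p. 118] -/
theorem galoisTwistAut_natural (Sc : ComplexRecordSystem L H τ T hT K₀) {K K' : C5.SmallLevel K₀} (f : K ⟶ K')
    (σ : ℂ ≃+* ℂ) {x₀ : Ball}
    {d : finAdelic (↥(maximalRealSubfield L)) L (IsCMField.complexConj L) 3 H}
    (lamK : (Sc.Mc.obj K).left ≅ (Sc.Mc.obj K).left) (lamK' : (Sc.Mc.obj K').left ≅ (Sc.Mc.obj K').left)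
    (hlamK : lamK.hom ≫ (Sc.Mc.obj K).hom = (Sc.Mc.obj K).hom ≫ Spec.map (CommRingCat.ofHom (σ.symm : ℂ →+* ℂ)))
    (hptK : ∀ a : finAdelic (↥(maximalRealSubfield L)) L (IsCMField.complexConj L) 3 H,
      Spec.map (CommRingCat.ofHom (σ : ℂ →+* ℂ)) ≫ ((Sc.pts K).symm (ShimuraSet.mk L H τ T hT K.1.1 x₀ a)).toSpecHom ≫ lamK.hom =
        ((Sc.pts K).symm (ShimuraSet.mk L H τ T hT K.1.1 x₀ (d * a))).toSpecHom)
    (hlamK' : lamK'.hom ≫ (Sc.Mc.obj K').hom = (Sc.Mc.obj K').hom ≫ Spec.map (CommRingCat.ofHom (σ.symm : ℂ →+* ℂ)))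
    (hptK' : ∀ a : finAdelic (↥(maximalRealSubfield L)) L (IsCMField.complexConj L) 3 H,
      Spec.map (CommRingCat.ofHom (σ : ℂ →+* ℂ)) ≫ ((Sc.pts K').symm (ShimuraSet.mk L H τ T hT K'.1.1 x₀ a)).toSpecHom ≫ lamK'.hom =
        ((Sc.pts K').symm (ShimuraSet.mk L H τ T hT K'.1.1 x₀ (d * a))).toSpecHom) :
    lamK.hom ≫ (Sc.Mc.map f).left = (Sc.Mc.map f).left ≫ lamK'.hom := by
  -- the transition morphism on the special points: `[z, aK] ↦ [z, aK']`
  have hmap : ∀ (z : Ball) (a : finAdelic (↥(maximalRealSubfield L)) L (IsCMField.complexConj L) 3 H),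
      AlgPoints.map (Sc.Mc.map f) ((Sc.pts K).symm (ShimuraSet.mk L H τ T hT K.1.1 z a)) =
        (Sc.pts K').symm (ShimuraSet.mk L H τ T hT K'.1.1 z a) := fun z a =>
    ((Sc.pts K').symm_apply_eq.mpr (Sc.map_pts K K' f z a).symm).symm
  -- `λ_K⁻¹` covers `Spec σ`
  have hinv : lamK.inv ≫ (Sc.Mc.obj K).hom = (Sc.Mc.obj K).hom ≫ Spec.map (CommRingCat.ofHom (σ : ℂ →+* ℂ)) := by
    have h := congrArg (fun g => lamK.inv ≫ g ≫ Spec.map (CommRingCat.ofHom (σ : ℂ →+* ℂ))) hlamK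
    simp only [Iso.inv_hom_id_assoc, Category.assoc] at h
    rw [specMap_ringEquiv_symm_comp, Category.comp_id] at h
    exact h.symm
  -- the `ℂ`-linear morphism `λ_K⁻¹ ≫ (Mc_K → Mc_{K'}) ≫ λ_{K'}`
  have hν : (lamK.inv ≫ (Sc.Mc.map f).left ≫ lamK'.hom) ≫ (Sc.Mc.obj K').hom = (Sc.Mc.obj K).hom := by
    rw [Category.assoc, Category.assoc, hlamK', ← Category.assoc (Sc.Mc.map f).left, Over.w (Sc.Mc.map f),
      reassoc_of% hinv, specMap_ringEquiv_comp_symm, Category.comp_id]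
  let ν : Sc.Mc.obj K ⟶ Sc.Mc.obj K' := Over.homMk (lamK.inv ≫ (Sc.Mc.map f).left ≫ lamK'.hom) hν
  -- it agrees with the transition morphism on the Hecke orbit of `x₀`
  have horbit : ∀ b : finAdelic (↥(maximalRealSubfield L)) L (IsCMField.complexConj L) 3 H,
      AlgPoints.map ν ((Sc.pts K).symm (ShimuraSet.mk L H τ T hT K.1.1 x₀ b)) =
        AlgPoints.map (Sc.Mc.map f) ((Sc.pts K).symm (ShimuraSet.mk L H τ T hT K.1.1 x₀ b)) := by
    intro b
    obtain ⟨a, rfl⟩ : ∃ a, d * a = b := ⟨d⁻¹ * b, mul_inv_cancel_left d b⟩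
    rw [hmap]
    apply Over.OverMorphism.ext
    change ((Sc.pts K).symm (ShimuraSet.mk L H τ T hT K.1.1 x₀ (d * a))).toSpecHom ≫
        (lamK.inv ≫ (Sc.Mc.map f).left ≫ lamK'.hom) =
      ((Sc.pts K').symm (ShimuraSet.mk L H τ T hT K'.1.1 x₀ (d * a))).toSpecHom
    have hpa : ((Sc.pts K).symm (ShimuraSet.mk L H τ T hT K.1.1 x₀ a)).toSpecHom ≫ (Sc.Mc.map f).left =
        ((Sc.pts K').symm (ShimuraSet.mk L H τ T hT K'.1.1 x₀ a)).left :=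
      congrArg CommaMorphism.left (hmap x₀ a)
    rw [← hptK a]
    simp only [Category.assoc, Iso.hom_inv_id_assoc]
    rw [reassoc_of% hpa, hptK' a]
  -- hence it IS the transition morphism (§1)
  have hνf : ν = Sc.Mc.map f := hom_eq_of_eq_on_heckeOrbit Sc x₀ ν (Sc.Mc.map f) horbit
  have h1 : lamK.inv ≫ (Sc.Mc.map f).left ≫ lamK'.hom = (Sc.Mc.map f).left := congrArg CommaMorphism.left hνf
  rw [← h1]
  simp only [Iso.hom_inv_id_assoc]
  rw [h1]

/-! ### §3. Existence from a form with reciprocity over `E ⊇ τ(L)` ([Deligne1979ShimuraVarieties] 2.2.5; [Milne2005ShimuraVarieties] (62)) -/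

/-- **The transported Galois automorphism of a form IS a Galois twist automorphism** (explicit form, for the lead of the
algebraic half): for an `E`-form `(M, e)` of `Sc` along `ιE : E → ℂ` with reciprocity (62) over `E` (`IsCanonicalDescentOver`),
`σ ∈ Aut_E(ℂ)`, an Artin correspondent `s` of (the ring automorphism underlying) `σ`, the CM point `x₀` of a negative `L`-line and
the twist `d` by `r_{x₀}(s)`, the composite `e_K⁻¹ ≫ (1 × Spec σ⁻¹) ≫ e_K` of underlying scheme morphisms — `GaloisDescent.gal ℂ (M_K) σ`
transported along `e_K` — covers `Spec σ⁻¹` and acts on the special points by (62): `Sc.pts⁻¹[x₀, aK] ↦ Sc.pts⁻¹[x₀, d·aK]`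
(`lift_comp_gal` + `hM`). [cite: Deligne1979ShimuraVarieties, 2.2.4–2.2.5] [cite: Milne2005ShimuraVarieties, Def. 12.8 (62) p. 114; §13 p. 118 L21–26] -/
theorem galoisTwistAut_transport (Sc : ComplexRecordSystem L H τ T hT K₀)
    {E : Type} [Field E] (ιE : E →+* ℂ) (M : C5.SmallLevel K₀ ⥤ SchemeOver E)
    (e : (M ⋙ Motives.baseChangeHom ιE) ≅ Sc.Mc) (hM : IsCanonicalDescentOver Sc ιE M e)
    (K : C5.SmallLevel K₀) (σE : letI : Algebra E ℂ := ιE.toAlgebra; ℂ ≃ₐ[E] ℂ)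
    {s : (FiniteAdeleRing (𝓞 L) L)ˣ}
    (hs : IsArtinCorrespondent L τ s (letI : Algebra E ℂ := ιE.toAlgebra; σE.toRingEquiv))
    {v₃ : Fin 3 → L} {x₀ : Ball} (hx₀ : IsLinePoint L τ T v₃ x₀)
    {d : finAdelic (↥(maximalRealSubfield L)) L (IsCMField.complexConj L) 3 H}
    (hd : IsDiagTwist L H v₃ (recipFactor L s) d) :
    letI : Algebra E ℂ := ιE.toAlgebra
    (((e.inv.app K).left : (Sc.Mc.obj K).left ⟶ GaloisDescent.bc ℂ (M.obj K)) ≫ GaloisDescent.gal ℂ (M.obj K) σE ≫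
          ((e.hom.app K).left : GaloisDescent.bc ℂ (M.obj K) ⟶ (Sc.Mc.obj K).left)) ≫ (Sc.Mc.obj K).hom =
        (Sc.Mc.obj K).hom ≫ Spec.map (CommRingCat.ofHom (σE.toRingEquiv.symm : ℂ →+* ℂ)) ∧
      ∀ a : finAdelic (↥(maximalRealSubfield L)) L (IsCMField.complexConj L) 3 H,
        Spec.map (CommRingCat.ofHom (σE.toRingEquiv : ℂ →+* ℂ)) ≫
            ((Sc.pts K).symm (ShimuraSet.mk L H τ T hT K.1.1 x₀ a)).toSpecHom ≫
              (((e.inv.app K).left : (Sc.Mc.obj K).left ⟶ GaloisDescent.bc ℂ (M.obj K)) ≫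
                GaloisDescent.gal ℂ (M.obj K) σE ≫ ((e.hom.app K).left : GaloisDescent.bc ℂ (M.obj K) ⟶ (Sc.Mc.obj K).left)) =
          ((Sc.pts K).symm (ShimuraSet.mk L H τ T hT K.1.1 x₀ (d * a))).toSpecHom := by
  letI : Algebra E ℂ := ιE.toAlgebra
  have hσE' : ((σE⁻¹ : ℂ ≃ₐ[E] ℂ) : ℂ →+* ℂ) = (σE.toRingEquiv.symm : ℂ →+* ℂ) := RingHom.ext fun _ => rfl
  -- reciprocity (62) of the `E`-form at `σ`: `σ • Q_a = Q_{d a}` for the points `Q_a ∈ M_K(ℂ)` read through `e`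
  have hrec : ∀ a : finAdelic (↥(maximalRealSubfield L)) L (IsCMField.complexConj L) 3 H,
      σE • (AlgPoints.baseChangeEquiv ιE (M.obj K)).symm
          (AlgPoints.map (e.inv.app K) ((Sc.pts K).symm (ShimuraSet.mk L H τ T hT K.1.1 x₀ a))) =
        (AlgPoints.baseChangeEquiv ιE (M.obj K)).symm
          (AlgPoints.map (e.inv.app K) ((Sc.pts K).symm (ShimuraSet.mk L H τ T hT K.1.1 x₀ (d * a)))) :=
    fun a => hM K σE s hs v₃ x₀ hx₀ d hd a
  -- the underlying scheme isomorphism of `e_K`, in the fibre-product spelling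
  let eL : GaloisDescent.bc ℂ (M.obj K) ≅ (Sc.Mc.obj K).left := (Over.forget _).mapIso (e.app K)
  have hw1 : eL.hom ≫ (Sc.Mc.obj K).hom = pullback.snd (M.obj K).hom (AbelianVariety.bcSpec E ℂ) :=
    Over.w (e.hom.app K)
  have hw2 : eL.inv ≫ pullback.snd (M.obj K).hom (AbelianVariety.bcSpec E ℂ) = (Sc.Mc.obj K).hom :=
    Over.w (e.inv.app K)
  have hgs : GaloisDescent.gal ℂ (M.obj K) σE ≫ pullback.snd (M.obj K).hom (AbelianVariety.bcSpec E ℂ) =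
      pullback.snd (M.obj K).hom (AbelianVariety.bcSpec E ℂ) ≫ AbelianVariety.specAut ℂ σE⁻¹ :=
    GaloisDescent.gal_snd ℂ (M.obj K) σE
  refine ⟨?_, fun a => ?_⟩
  · -- `λ` covers `Spec σ⁻¹`
    show (eL.inv ≫ GaloisDescent.gal ℂ (M.obj K) σE ≫ eL.hom) ≫ (Sc.Mc.obj K).hom =
      (Sc.Mc.obj K).hom ≫ Spec.map (CommRingCat.ofHom (σE.toRingEquiv.symm : ℂ →+* ℂ))
    rw [Category.assoc, Category.assoc, hw1, hgs, reassoc_of% hw2]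
    dsimp only [AbelianVariety.specAut]
    rw [hσE']
  · -- the point action is (62): points of `Sc.Mc_K(ℂ)` read in `M_K(ℂ)` through `e_K`, moved by `lift_comp_gal`
    have h1 : ∀ b : finAdelic (↥(maximalRealSubfield L)) L (IsCMField.complexConj L) 3 H,
        ((Sc.pts K).symm (ShimuraSet.mk L H τ T hT K.1.1 x₀ b)).toSpecHom ≫ eL.inv =
          (AlgPoints.baseChangeEquiv ιE (M.obj K) ((AlgPoints.baseChangeEquiv ιE (M.obj K)).symm
            (AlgPoints.map (e.inv.app K) ((Sc.pts K).symm (ShimuraSet.mk L H τ T hT K.1.1 x₀ b))))).left := by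
      intro b
      rw [Equiv.apply_symm_apply]
      rfl
    have hσspec : AbelianVariety.specAut ℂ σE⁻¹ = Spec.map (CommRingCat.ofHom (σE.toRingEquiv.symm : ℂ →+* ℂ)) := by
      dsimp only [AbelianVariety.specAut]
      rw [hσE']
    exact specMap_comp_comp_conj_gal_eq (ιE := ιE) (M.obj K) σE σE.toRingEquiv hσspec _ _ (hrec a) eL _ _
      (h1 a) (h1 (d * a))

/-- **A form of the tower over `E` with Shimura reciprocity supplies a Galois twist automorphism of every
`σ ∈ Aut(ℂ/E)`**: given an `E`-form `(M, e)` of `Sc` (along `ιE : E → ℂ`) with reciprocity (62) at the diagonal special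
pairs over `E` (`IsCanonicalDescentOver Sc ιE M e`), a ring automorphism `σ` of `ℂ` fixing `ιE(E)` pointwise, an Artin
correspondent `s` of `σ`, the CM point `x₀` of a negative `L`-line and the diagonal twist `d` by `r_{x₀}(s)`, there is an
automorphism of `(Sc.Mc_K).left` covering `Spec σ⁻¹` whose point action IS (62) — namely the transported Galois automorphism of
`galoisTwistAut_transport` (with `σ` regarded in `Aut_E(ℂ)`). [cite: Deligne1979ShimuraVarieties, 2.2.4–2.2.5]
[cite: Milne2005ShimuraVarieties, Def. 12.8 (62) p. 114; §13 p. 118 L21–26] -/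
theorem exists_galoisTwistAut_of_isCanonicalDescentOver (Sc : ComplexRecordSystem L H τ T hT K₀)
    {E : Type} [Field E] (ιE : E →+* ℂ) (M : C5.SmallLevel K₀ ⥤ SchemeOver E)
    (e : (M ⋙ Motives.baseChangeHom ιE) ≅ Sc.Mc) (hM : IsCanonicalDescentOver Sc ιE M e)
    (K : C5.SmallLevel K₀) (σ : ℂ ≃+* ℂ) (hσ : ∀ x : E, σ (ιE x) = ιE x)
    {s : (FiniteAdeleRing (𝓞 L) L)ˣ} (hs : IsArtinCorrespondent L τ s σ)
    {v₃ : Fin 3 → L} {x₀ : Ball} (hx₀ : IsLinePoint L τ T v₃ x₀)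
    {d : finAdelic (↥(maximalRealSubfield L)) L (IsCMField.complexConj L) 3 H}
    (hd : IsDiagTwist L H v₃ (recipFactor L s) d) :
    ∃ lam : (Sc.Mc.obj K).left ≅ (Sc.Mc.obj K).left,
      lam.hom ≫ (Sc.Mc.obj K).hom = (Sc.Mc.obj K).hom ≫ Spec.map (CommRingCat.ofHom (σ.symm : ℂ →+* ℂ)) ∧
      ∀ a : finAdelic (↥(maximalRealSubfield L)) L (IsCMField.complexConj L) 3 H,
        Spec.map (CommRingCat.ofHom (σ : ℂ →+* ℂ)) ≫ ((Sc.pts K).symm (ShimuraSet.mk L H τ T hT K.1.1 x₀ a)).toSpecHom ≫ lam.hom =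
          ((Sc.pts K).symm (ShimuraSet.mk L H τ T hT K.1.1 x₀ (d * a))).toSpecHom := by
  letI : Algebra E ℂ := ιE.toAlgebra
  -- `σ` as an automorphism of the `E`-algebra `ℂ`; its underlying ring automorphism is `σ`
  let σE : ℂ ≃ₐ[E] ℂ := AlgEquiv.ofRingEquiv (f := σ) fun x => hσ x
  let galIso : GaloisDescent.bc ℂ (M.obj K) ≅ GaloisDescent.bc ℂ (M.obj K) :=
    ⟨GaloisDescent.gal ℂ (M.obj K) σE, GaloisDescent.gal ℂ (M.obj K) σE⁻¹,
      GaloisDescent.gal_comp_gal_symm ℂ (M.obj K) σE, GaloisDescent.gal_symm_comp_gal ℂ (M.obj K) σE⟩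
  let eL : GaloisDescent.bc ℂ (M.obj K) ≅ (Sc.Mc.obj K).left := (Over.forget _).mapIso (e.app K)
  exact ⟨eL.symm ≪≫ galIso ≪≫ eL, galoisTwistAut_transport Sc ιE M e hM K σE hs hx₀ hd⟩

/-! ### §4. The identity and composites ([Deligne1971TravauxShimura] Lemme 5.10.1: the datum is a group action) -/

/-- **The identity is the Galois twist automorphism of `σ = 1`** (with the Artin correspondent `s = 1` and the trivial twist
`d = 1`: `IsArtinCorrespondent L τ 1 1` is the tree's `isArtinCorrespondent_one_one`, and `r(1) = 1`).
[cite: Milne2005ShimuraVarieties, Def. 12.8 (62) p. 114] -/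
theorem galoisTwistAut_one (Sc : ComplexRecordSystem L H τ T hT K₀) (K : C5.SmallLevel K₀) (x₀ : Ball) :
    (Iso.refl (Sc.Mc.obj K).left).hom ≫ (Sc.Mc.obj K).hom =
        (Sc.Mc.obj K).hom ≫ Spec.map (CommRingCat.ofHom ((RingEquiv.refl ℂ).symm : ℂ →+* ℂ)) ∧
      ∀ a : finAdelic (↥(maximalRealSubfield L)) L (IsCMField.complexConj L) 3 H,
        Spec.map (CommRingCat.ofHom ((RingEquiv.refl ℂ) : ℂ →+* ℂ)) ≫
            ((Sc.pts K).symm (ShimuraSet.mk L H τ T hT K.1.1 x₀ a)).toSpecHom ≫ (Iso.refl (Sc.Mc.obj K).left).hom =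
          ((Sc.pts K).symm (ShimuraSet.mk L H τ T hT K.1.1 x₀ (1 * a))).toSpecHom := by
  have h1 : Spec.map (CommRingCat.ofHom ((RingEquiv.refl ℂ) : ℂ →+* ℂ)) = 𝟙 _ := by
    have h : ((RingEquiv.refl ℂ) : ℂ →+* ℂ) = RingHom.id ℂ := RingHom.ext fun _ => rfl
    rw [h, CommRingCat.ofHom_id]; exact Spec.map_id _
  have h2 : Spec.map (CommRingCat.ofHom ((RingEquiv.refl ℂ).symm : ℂ →+* ℂ)) = 𝟙 _ := by
    have h : ((RingEquiv.refl ℂ).symm : ℂ →+* ℂ) = RingHom.id ℂ := RingHom.ext fun _ => rfl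
    rw [h, CommRingCat.ofHom_id]; exact Spec.map_id _
  refine ⟨?_, fun a => ?_⟩
  · rw [h2, Iso.refl_hom, Category.id_comp, Category.comp_id]
  · rw [h1, Iso.refl_hom, Category.id_comp, Category.comp_id, one_mul]

set_option maxHeartbeats 400000 in -- heartbeat budget (ops-buildfix B30): `rw [← hptσ (dρ * a), ← hptρ a]` isDefEq times out at 160000
/-- **Composites of Galois twist automorphisms**: if `λ_τ` is a twist automorphism for `τ` (point action `a ↦ d_τ·a`) and
`λ_σ` one for `σ` (point action `a ↦ d_σ·a`) at the same level and CM point, then `λ_τ ≫ λ_σ` is a twist automorphism for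
`σ·τ` with point action `a ↦ (d_σ·d_τ)·a` — it covers `Spec τ⁻¹ ≫ Spec σ⁻¹ = Spec (σ·τ)⁻¹` and
`Spec(σ·τ) ≫ P ≫ λ_τ ≫ λ_σ = Spec σ ≫ (Spec τ ≫ P ≫ λ_τ) ≫ λ_σ`.  (That `d_σ·d_τ` is the twist of the Artin correspondent
`s_σ·s_τ` of `σ·τ` is `IsArtinCorrespondent.mul` ∕ `recipFactor_mul` ∕ `IsDiagTwist.mul` below.)
[cite: Deligne1971TravauxShimura, Lemme 5.10.1 (p. 158)] [cite: Milne2005ShimuraVarieties, Def. 12.8 (62) p. 114] -/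
theorem galoisTwistAut_mul (Sc : ComplexRecordSystem L H τ T hT K₀) (K : C5.SmallLevel K₀) (σ ρ : ℂ ≃+* ℂ) (x₀ : Ball)
    {dσ dρ : finAdelic (↥(maximalRealSubfield L)) L (IsCMField.complexConj L) 3 H}
    (lamσ lamρ : (Sc.Mc.obj K).left ≅ (Sc.Mc.obj K).left)
    (hlamσ : lamσ.hom ≫ (Sc.Mc.obj K).hom = (Sc.Mc.obj K).hom ≫ Spec.map (CommRingCat.ofHom (σ.symm : ℂ →+* ℂ)))
    (hptσ : ∀ a : finAdelic (↥(maximalRealSubfield L)) L (IsCMField.complexConj L) 3 H,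
      Spec.map (CommRingCat.ofHom (σ : ℂ →+* ℂ)) ≫ ((Sc.pts K).symm (ShimuraSet.mk L H τ T hT K.1.1 x₀ a)).toSpecHom ≫ lamσ.hom =
        ((Sc.pts K).symm (ShimuraSet.mk L H τ T hT K.1.1 x₀ (dσ * a))).toSpecHom)
    (hlamρ : lamρ.hom ≫ (Sc.Mc.obj K).hom = (Sc.Mc.obj K).hom ≫ Spec.map (CommRingCat.ofHom (ρ.symm : ℂ →+* ℂ)))
    (hptρ : ∀ a : finAdelic (↥(maximalRealSubfield L)) L (IsCMField.complexConj L) 3 H,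
      Spec.map (CommRingCat.ofHom (ρ : ℂ →+* ℂ)) ≫ ((Sc.pts K).symm (ShimuraSet.mk L H τ T hT K.1.1 x₀ a)).toSpecHom ≫ lamρ.hom =
        ((Sc.pts K).symm (ShimuraSet.mk L H τ T hT K.1.1 x₀ (dρ * a))).toSpecHom) :
    (lamρ ≪≫ lamσ).hom ≫ (Sc.Mc.obj K).hom = (Sc.Mc.obj K).hom ≫ Spec.map (CommRingCat.ofHom ((σ * ρ).symm : ℂ →+* ℂ)) ∧
      ∀ a : finAdelic (↥(maximalRealSubfield L)) L (IsCMField.complexConj L) 3 H,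
        Spec.map (CommRingCat.ofHom ((σ * ρ : ℂ ≃+* ℂ) : ℂ →+* ℂ)) ≫
            ((Sc.pts K).symm (ShimuraSet.mk L H τ T hT K.1.1 x₀ a)).toSpecHom ≫ (lamρ ≪≫ lamσ).hom =
          ((Sc.pts K).symm (ShimuraSet.mk L H τ T hT K.1.1 x₀ (dσ * dρ * a))).toSpecHom := by
  refine ⟨?_, fun a => ?_⟩
  · rw [Iso.trans_hom, Category.assoc, hlamσ, reassoc_of% hlamρ, specMap_ringEquiv_mul_symm]
  · rw [Iso.trans_hom, specMap_ringEquiv_mul, mul_assoc, ← hptσ (dρ * a), ← hptρ a]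
    simp only [Category.assoc]

/-- **Inverses of Galois twist automorphisms**: if `λ` is a twist automorphism for `σ` with point action `a ↦ d·a`, then
`λ⁻¹` is one for `σ⁻¹` with point action `a ↦ d⁻¹·a` (it covers `Spec σ = Spec (σ⁻¹)⁻¹`, and
`Spec σ⁻¹ ≫ P_a ≫ λ⁻¹ = P_{d⁻¹ a}` is `Spec σ ≫ P_{d⁻¹a} ≫ λ = P_a` composed with `Spec σ⁻¹` and `λ⁻¹`).  (That `d⁻¹` is the twist of the
Artin correspondent `s⁻¹` of `σ⁻¹` is `IsArtinCorrespondent.inv` ∕ `IsDiagTwist.inv_of_recipFactor` below.)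
[cite: Deligne1971TravauxShimura, Lemme 5.10.1 (p. 158)] [cite: Milne2005ShimuraVarieties, Def. 12.8 (62) p. 114] -/
theorem galoisTwistAut_symm (Sc : ComplexRecordSystem L H τ T hT K₀) (K : C5.SmallLevel K₀) (σ : ℂ ≃+* ℂ) (x₀ : Ball)
    {d : finAdelic (↥(maximalRealSubfield L)) L (IsCMField.complexConj L) 3 H}
    (lam : (Sc.Mc.obj K).left ≅ (Sc.Mc.obj K).left)
    (hlam : lam.hom ≫ (Sc.Mc.obj K).hom = (Sc.Mc.obj K).hom ≫ Spec.map (CommRingCat.ofHom (σ.symm : ℂ →+* ℂ)))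
    (hpt : ∀ a : finAdelic (↥(maximalRealSubfield L)) L (IsCMField.complexConj L) 3 H,
      Spec.map (CommRingCat.ofHom (σ : ℂ →+* ℂ)) ≫ ((Sc.pts K).symm (ShimuraSet.mk L H τ T hT K.1.1 x₀ a)).toSpecHom ≫ lam.hom =
        ((Sc.pts K).symm (ShimuraSet.mk L H τ T hT K.1.1 x₀ (d * a))).toSpecHom) :
    (lam.symm.hom ≫ (Sc.Mc.obj K).hom = (Sc.Mc.obj K).hom ≫ Spec.map (CommRingCat.ofHom ((σ⁻¹).symm : ℂ →+* ℂ))) ∧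
      ∀ a : finAdelic (↥(maximalRealSubfield L)) L (IsCMField.complexConj L) 3 H,
        Spec.map (CommRingCat.ofHom ((σ⁻¹ : ℂ ≃+* ℂ) : ℂ →+* ℂ)) ≫
            ((Sc.pts K).symm (ShimuraSet.mk L H τ T hT K.1.1 x₀ a)).toSpecHom ≫ lam.symm.hom =
          ((Sc.pts K).symm (ShimuraSet.mk L H τ T hT K.1.1 x₀ (d⁻¹ * a))).toSpecHom := by
  -- `λ⁻¹` covers `Spec σ`
  have hinv : lam.inv ≫ (Sc.Mc.obj K).hom = (Sc.Mc.obj K).hom ≫ Spec.map (CommRingCat.ofHom (σ : ℂ →+* ℂ)) := by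
    have h := congrArg (fun f => lam.inv ≫ f ≫ Spec.map (CommRingCat.ofHom (σ : ℂ →+* ℂ))) hlam
    simp only [Iso.inv_hom_id_assoc, Category.assoc] at h
    rw [specMap_ringEquiv_symm_comp, Category.comp_id] at h
    exact h.symm
  refine ⟨hinv, fun a => ?_⟩
  show Spec.map (CommRingCat.ofHom (σ.symm : ℂ →+* ℂ)) ≫
      ((Sc.pts K).symm (ShimuraSet.mk L H τ T hT K.1.1 x₀ a)).toSpecHom ≫ lam.inv =
    ((Sc.pts K).symm (ShimuraSet.mk L H τ T hT K.1.1 x₀ (d⁻¹ * a))).toSpecHom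
  have h := hpt (d⁻¹ * a)
  rw [mul_inv_cancel_left] at h
  rw [← h]
  simp only [Category.assoc, Iso.hom_inv_id, Category.comp_id]
  rw [reassoc_of% (specMap_ringEquiv_symm_comp σ)]

/-- **The point action of a Galois twist automorphism may be read with ANY Artin correspondent and twist of `σ`**: if `λ`
sends `Sc.pts⁻¹[x₀, aK] ↦ Sc.pts⁻¹[x₀, d·aK]` for the data `(s, d)` of `σ`, then also `↦ Sc.pts⁻¹[x₀, d′·aK]` for any other data
`(s′, d′)` of `σ` — the twist class `[x₀, r_{x₀}(s)·aK]` depends only on `σ` (`shimuraSet_mk_twist_eq_of_isArtinCorrespondent`,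
[Milne2005ShimuraVarieties] Def. 12.8: «for any `s` with `art(s) = σ`»). [cite: Milne2005ShimuraVarieties, Def. 12.8 (62) p. 114] -/
theorem galoisTwistAut_pt_of_pt (Sc : ComplexRecordSystem L H τ T hT K₀) (K : C5.SmallLevel K₀) (σ : ℂ ≃+* ℂ)
    {v₃ : Fin 3 → L} {x₀ : Ball} (hx₀ : IsLinePoint L τ T v₃ x₀)
    {s s' : (FiniteAdeleRing (𝓞 L) L)ˣ} (hs : IsArtinCorrespondent L τ s σ) (hs' : IsArtinCorrespondent L τ s' σ)
    {d d' : finAdelic (↥(maximalRealSubfield L)) L (IsCMField.complexConj L) 3 H}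
    (hd : IsDiagTwist L H v₃ (recipFactor L s) d) (hd' : IsDiagTwist L H v₃ (recipFactor L s') d')
    {lamK : (Sc.Mc.obj K).left ⟶ (Sc.Mc.obj K).left}
    (hpt : ∀ a : finAdelic (↥(maximalRealSubfield L)) L (IsCMField.complexConj L) 3 H,
      Spec.map (CommRingCat.ofHom (σ : ℂ →+* ℂ)) ≫ ((Sc.pts K).symm (ShimuraSet.mk L H τ T hT K.1.1 x₀ a)).toSpecHom ≫ lamK =
        ((Sc.pts K).symm (ShimuraSet.mk L H τ T hT K.1.1 x₀ (d * a))).toSpecHom)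
    (a : finAdelic (↥(maximalRealSubfield L)) L (IsCMField.complexConj L) 3 H) :
    Spec.map (CommRingCat.ofHom (σ : ℂ →+* ℂ)) ≫ ((Sc.pts K).symm (ShimuraSet.mk L H τ T hT K.1.1 x₀ a)).toSpecHom ≫ lamK =
      ((Sc.pts K).symm (ShimuraSet.mk L H τ T hT K.1.1 x₀ (d' * a))).toSpecHom := by
  have hv : hermForm (cmConjRingHom L) H v₃ v₃ ≠ 0 := hermForm_self_ne_zero_of_isLinePoint L H τ T hT hx₀
  rw [hpt a, shimuraSet_mk_twist_eq_of_isArtinCorrespondent L H τ T hT K.1.1 hs hs' hv hx₀ hd hd' a]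

end ComplexRecordSystem

end Literature.AlgebraicGeometry.ShimuraVarieties.UnitaryCanonicalModel

end
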